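import Literature.AlgebraicGeometry.Modules.CechRefineToOrdered
import Literature.AlgebraicGeometry.Modules.CechSectionsCochainDictionary
import Literature.AlgebraicGeometry.Modules.CechPullbackSystemHom
import Literature.Algebra.Homology.OrderedCechSystemFullRefine
import Literature.Algebra.Homology.OrderedCechSystemRefineMap
import HarnessLib

/-!
# The refinement map between the ORDERED module Čech complexes of two affine covers is an isomorphism on
# cohomology (The Stacks Project, Tags 01FG, 01FM, 01XD; Görtz–Wedhorn II Thm. 22.9; Hartshorne III Lemma 4.4, Thm. 4.5)

Topic `AlgebraicGeometry/Modules`; namespace `Literature.AlgebraicGeometry.Modules`.  PROOF file (theorems only: no definition,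
no named fact, no instance, no notation, no `sorry`).  Cell `hodgecm-mathlib` FLOOR 0, P1 sub-line F-11, packet (iv)∕J3, letter
**(G5-c) «`r^*` is bijective»** (F0P1b-plan (g0) (R76); B-p01 (g17)), FILE B = the ALGEBRAIC half of ★ FILE A
`Modules/CechRefineToOrdered`, transported through the cochain dictionaries ★ D20 `Modules/CechSectionsCochainDictionary` to
★ `Modules.cechComplex 𝓤 M ρ = OrderedCech.sysComplex (sectionsSystem 𝓤 M ρ)` and ★ `OrderedCech.refineCochain θ φ` along an
ARBITRARY index map `θ`.  HC_CM is proved only modulo the 7 printed citations until rung 0 closes — nothing here bears on it.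

Setting: `X : Scheme.{0}`, finite linearly ordered families of opens `𝓤 = (U_i)`, `𝓥 = (V_j)`, `θ : ι′ → ι` with `V_j ≤ U_{θ j}`,
an `𝒪_X`-module `M`, `ρ : A → Γ(X, 𝒪_X)`, and a restriction datum `φ : θ(·)^* S_𝓤 ⟶ S_𝓥` (`S_𝓤 := sectionsSystem 𝓤 M ρ`)
CHARACTERISED by `hφ : (φ.app s′) x = x|_{V_{s′}}` (e.g. ★ `pullbackSystemHom (𝟙 X) …`, §4).
* §0 `OrderedCech.Full.ext_res_zero` (`ext ∘ res = 𝟙` in degree `0`); §1 `cechOpen_le_cechOpen_image`, and the dictionary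
  **`Cech.sectionsToCochain_refineAlong`** (★ `Cech.refineAlong` ↦ ★ `OrderedCech.Full.pullbackCochain θ φ`);
* §2 COCHAIN CURRENCY (covers with affine non-empty finite intersections, `M` affine-localizing):
  **`OrderedCech.exists_eq_sysD_of_refineCochain_eq_sysD`** (injectivity), **`OrderedCech.exists_refineCochain_eq_add_sysD`**
  (surjectivity), degree-`0` twins `eq_zero_of_refineCochain_eq_zero` ∕ `exists_refineCochain_eq_zero` — from FILE A via
  `refine = res ∘ Θ_θ ∘ ext` (★ `Full.res_pullbackCochain_ext`), ★ `Full.res_ext`, ★ `Full.d_ext`, ★ `Full.sysD_res` and the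
  injectivity of `H(res)` (★ `Full.exists_d_eq_of_res_eq_sysD`);
* §3 CLASS FORM **`Modules.homologyMap_bijective_of_refineCochain`**: every cochain map whose components ARE `refineCochain θ φ`
  (e.g. ★ `OrderedCech.refineComplexMap θ φ`) is BIJECTIVE on `Ȟⁿ`, `n : ℤ` (★ `HomologyElementwise.homologyMap_bijective_of_elementwise`);
* §4 the F-J3b instance **`Modules.homologyMap_refineComplexMap_pullbackSystemHom_id_bijective`** (`M := 𝒪_X`, ★ `IsAffineLocalizing.unit`,
  `φ := pullbackSystemHom (𝟙 X) …`): `r^*` of the product∕triple covers of `A × A` is bijective, so `m^* := (r^*)⁻¹ ∘ H(refine_{θ_m})` exists.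

## References
* The Stacks Project, Tags 01FG (Čech complexes, refinements), 01FM (ordered complex), 01XD (quasi-coherent Čech cohomology). [StacksProject]
* U. Görtz, T. Wedhorn, *Algebraic Geometry II* (2023), Def. 21.64, Def. 21.68 (pp. 179–181), Thm. 22.9 (p. 236). [GortzWedhorn2023]
* R. Hartshorne, *Algebraic Geometry*, GTM 52 (1977), III Lemma 4.4, Thm. 4.5 (pp. 220–222). [Hartshorne1977]
-/

noncomputable section

open CategoryTheory CategoryTheory.Abelian CategoryTheory.Limits Opposite TopologicalSpace AlgebraicGeometry Literature.Algebra.Homology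

set_option backward.isDefEq.respectTransparency false -- `ModuleCat`-valued functors (as in ★ `OrderedCechSystem`, ★ D20)

/-! ## §0 In degree `0` every full cochain is alternating: `ext ∘ res = 𝟙` -/

namespace Literature.Algebra.Homology.OrderedCech.Full

variable {ι : Type} [LinearOrder ι] {A : Type} [CommRing A] (S : Finset ι ⥤ ModuleCat.{0} A)

/-- **In degree `0`, `ext ∘ res = 𝟙` on full cochains** (a `1`-tuple has no inversions and no repeats). [cite: StacksProject, Tag 01FG] -/
theorem ext_res_zero (c : Cochain S 0) : ext S 0 (res S 0 c) = c := by
  funext α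
  have h01 : ∀ a b : Fin (0 + 1), a = b := fun a b => Fin.ext (by have := a.isLt; have := b.isLt; omega)
  have hα : StrictMono α := fun a b h => absurd h (by rw [h01 a b]; exact lt_irrefl _)
  have hs : Finset.univ.image α = {α 0} :=
    Finset.eq_singleton_iff_unique_mem.2 ⟨Finset.mem_image_of_mem α (Finset.mem_univ 0), fun i hi => by
      obtain ⟨j, -, rfl⟩ := Finset.mem_image.1 hi
      rw [h01 j 0]⟩
  have hσ : (Finset.univ.image α).Nonempty ∧ ((Finset.univ.image α).card : ℤ) = ((0 : ℕ) : ℤ) + 1 := by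
    rw [hs, Finset.card_singleton]; exact ⟨Finset.singleton_nonempty _, by simp⟩
  let σ : Simplex ι ((0 : ℕ) : ℤ) := ⟨Finset.univ.image α, hσ⟩
  rw [ext_apply, SysCochain.altEvalAt_of_strictMono _ hα]
  change (res S 0 c).ext0At σ.1 σ.1 = c α
  rw [SysCochain.ext0At_self, res_apply]
  have he : (⇑(σ.1.orderEmbOfFin (card_simplex 0 σ)) : Fin (0 + 1) → ι) = α := by
    funext i
    rw [h01 i 0]
    have hmem := Finset.orderEmbOfFin_mem σ.1 (card_simplex 0 σ) 0
    change σ.1.orderEmbOfFin (card_simplex 0 σ) 0 ∈ Finset.univ.image α at hmem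
    rw [hs, Finset.mem_singleton] at hmem
    exact hmem
  exact map_congr_apply S c he

end Literature.Algebra.Homology.OrderedCech.Full

namespace Literature.AlgebraicGeometry.Modules

variable {X : Scheme.{0}} {ι ι' : Type} [LinearOrder ι] [LinearOrder ι'] (U : ι → X.Opens) (V : ι' → X.Opens)
  (M : X.Modules) {A : Type} [CommRing A] (ρ : A →+* Γ(X, ⊤)) (θ : ι' → ι) (hV : ∀ j, V j ≤ U (θ j))

/-! ## §1 The refinement inequality and the dictionary for `refineAlong` -/

omit [LinearOrder ι'] in
include hV in
/-- **`V_{s′} ≤ U_{θ(s′)}`** for a family `𝓥` refining `𝓤` along `θ`. [cite: StacksProject, Tag 01FG] -/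
theorem cechOpen_le_cechOpen_image (s' : Finset ι') : cechOpen V s' ≤ cechOpen U (s'.image θ) := by
  refine Finset.le_inf fun i hi => ?_
  obtain ⟨j, hj, rfl⟩ := Finset.mem_image.1 hi
  exact (cechOpen_le V hj).trans (hV j)

variable (φ : OrderedCech.imageFunctor θ ⋙ sectionsSystem U M ρ ⟶ sectionsSystem V M ρ)
  (hφ : ∀ (s' : Finset ι') (x : SecMod M ρ (cechOpen U (s'.image θ))),
    (φ.app s').hom x = SecMod.res M ρ (cechOpen_le_cechOpen_image U V θ hV s') x)

include hφ in
/-- **The full dictionary ★ `Cech.sectionsToCochain` carries the sheaf-level refinement ★ `Cech.refineAlong M θ hV`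
(`(c_α) ↦ (c_{θ ∘ α′}|)`) to the algebraic pull-back ★ `OrderedCech.Full.pullbackCochain θ φ`** (any `φ` with `hφ`).
[cite: StacksProject, Tag 01FG] [cite: GortzWedhorn2023, Def. 21.64 (p. 179)] -/
theorem Cech.sectionsToCochain_refineAlong (n : ℕ) (c : Cech.Sections U n M ⊤) :
    Cech.sectionsToCochain V M ρ n ((Cech.refineAlong M θ hV n).app ⊤ c) =
      OrderedCech.Full.pullbackCochain θ φ n (Cech.sectionsToCochain U M ρ n c) := by
  funext α'
  apply SecMod.val_injective (L := M) (ρ := ρ)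
  rw [Cech.val_sectionsToCochain_apply, Cech.refineAlong_app_apply, Cech.res_res, OrderedCech.Full.pullbackCochain_apply, hφ,
    SecMod.val_res, sectionsSystem_map_apply]
  change _ = Cech.res M _ (Cech.res M _ (Cech.res M _ (c _)))
  rw [Cech.res_res, Cech.res_res]

/-! ## §2 The comparison in cochain currency -/

section Cochain

variable (hUa : ∀ s : Finset ι, s.Nonempty → IsAffineOpen (cechOpen U s))
  (hVa : ∀ s : Finset ι', s.Nonempty → IsAffineOpen (cechOpen V s))
  (hUcov : ⨆ i, U i = ⊤) (hVcov : ⨆ j, V j = ⊤) (hM : IsAffineLocalizing M)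

include hUa in
omit [LinearOrder ι'] in
/-- Affine non-empty finite intersections ⇒ affine faces of all tuples. [cite: GortzWedhorn2023, Def. 21.64 (p. 179)] -/
theorem isAffineOpen_face_of_cechOpen {m : ℕ} (β : Fin (m + 1) → ι) : IsAffineOpen (face U β) := by
  rw [face_eq_cechOpen_image]
  exact hUa _ ⟨β 0, Finset.mem_image_of_mem β (Finset.mem_univ 0)⟩

include hVa in
omit [LinearOrder ι] [LinearOrder ι'] in
/-- Affine non-empty finite intersections in the `faceSet` spelling. [cite: GortzWedhorn2023, Def. 21.64 (p. 179)] -/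
theorem isAffineOpen_faceSet_of_cechOpen (s : Finset ι') (hs : s.Nonempty) : IsAffineOpen (CechOrd.faceSet V s) := by
  rw [faceSet_eq_cechOpen]; exact hVa s hs

variable [Fintype ι] [Fintype ι']

include hφ hUa hVa hUcov hVcov hM in
omit [Fintype ι] in
/-- **Injectivity of the refinement on ordered Čech cohomology, cochain currency, positive degree**: for finite covers `𝓤`, `𝓥`
of `X` with affine non-empty finite intersections, `𝓥` refining `𝓤` along ANY `θ`, `M` affine-localizing, an ordered `(k+1)`-cocycle
`g` on `𝓤` with `refineCochain θ φ g = sysD h` is an ordered coboundary (FILE A at the full cocycle `ext g`, `refine = res ∘ Θ_θ ∘ ext`).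
[cite: StacksProject, Tag 01XD] [cite: StacksProject, Tag 01FG] [cite: Hartshorne1977, III Lemma 4.4, Thm. 4.5] -/
theorem _root_.Literature.Algebra.Homology.OrderedCech.exists_eq_sysD_of_refineCochain_eq_sysD (k : ℕ)
    (g : OrderedCech.SysCochain (sectionsSystem U M ρ) ((k : ℤ) + 1))
    (hg : OrderedCech.sysD (sectionsSystem U M ρ) ((k : ℤ) + 1) g = 0)
    (h : OrderedCech.SysCochain (sectionsSystem V M ρ) (k : ℤ))
    (hr : OrderedCech.refineCochain θ φ ((k : ℤ) + 1) g = OrderedCech.sysD (sectionsSystem V M ρ) (k : ℤ) h) :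
    ∃ g₀ : OrderedCech.SysCochain (sectionsSystem U M ρ) (k : ℤ), OrderedCech.sysD (sectionsSystem U M ρ) (k : ℤ) g₀ = g := by
  letI := HasExt.standard X.Modules
  set c : OrderedCech.Full.Cochain (sectionsSystem U M ρ) (k + 1) := OrderedCech.Full.ext (sectionsSystem U M ρ) (k + 1) g with hc
  have hg' : OrderedCech.sysD (sectionsSystem U M ρ) ((k + 1 : ℕ) : ℤ) g = 0 := hg
  have hdc : ((OrderedCech.Full.complex (sectionsSystem U M ρ)).d (k + 1) (k + 1 + 1)).hom c = 0 := by
    rw [hc, OrderedCech.Full.d_ext, hg', map_zero]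
  have hres : OrderedCech.Full.res (sectionsSystem V M ρ) (k + 1) (OrderedCech.Full.pullbackCochain θ φ (k + 1) c) =
      OrderedCech.sysD (sectionsSystem V M ρ) (k : ℤ) h := by
    rw [hc, OrderedCech.Full.res_pullbackCochain_ext]
    exact hr
  set c' : Cech.Sections U (k + 1) M ⊤ := (Cech.sectionsToCochain U M ρ (k + 1)).symm c with hc'
  set h' : Cech.Sections (CechOrd.faces V k) 0 M ⊤ := (CechOrd.sectionsToSysCochain V M ρ k).symm h with hh'
  have hcc : Cech.sectionsToCochain U M ρ (k + 1) c' = c := AddEquiv.apply_symm_apply _ c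
  have hhh : CechOrd.sectionsToSysCochain V M ρ k h' = h := AddEquiv.apply_symm_apply _ h
  have hdc' : Cech.dSections U M (k + 1) ⊤ c' = 0 := by
    apply (Cech.sectionsToCochain U M ρ (k + 1 + 1)).injective
    rw [Cech.sectionsToCochain_dSections, hcc, hdc, map_zero]
  have hres' : ((CechOrd.resOfFullObj V M (k + 1)).app ⊤ ((Cech.refineAlong M θ hV (k + 1)).app ⊤ c') :
      Cech.Sections (CechOrd.faces V (k + 1)) 0 M ⊤) = (CechOrd.d V M k).app ⊤ h' := by
    apply (CechOrd.sectionsToSysCochain V M ρ (k + 1)).injective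
    rw [CechOrd.sectionsToSysCochain_resOfFullObj, Cech.sectionsToCochain_refineAlong U V M ρ θ hV φ hφ, hcc, hres,
      CechOrd.sectionsToSysCochain_d, hhh]
  obtain ⟨w', hw'⟩ := CechOrd.exists_dSections_eq_of_refineRes_eq_d U V M θ hV
    (fun β => isAffineOpen_face_of_cechOpen U hUa β) (isAffineOpen_faceSet_of_cechOpen V hVa) hUcov hVcov hM k c' hdc' h' hres'
  refine ⟨OrderedCech.Full.res (sectionsSystem U M ρ) k (Cech.sectionsToCochain U M ρ k w'), ?_⟩
  rw [OrderedCech.Full.sysD_res, ← Cech.sectionsToCochain_dSections, hw', hcc, hc, OrderedCech.Full.res_ext]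

include hφ hUa hVa hUcov hVcov hM in
/-- **Surjectivity of the refinement on ordered Čech cohomology, cochain currency, positive degree**: under the same hypotheses
every ordered `(k+1)`-cocycle `g′` on `𝓥` is `refineCochain θ φ g + sysD h` for an ordered cocycle `g` on `𝓤` (FILE A gives a FULL
cocycle `c`; `g := res c`, and `ext (res c) − c` restricts to `0`, hence is a full coboundary by ★ `Full.exists_d_eq_of_res_eq_sysD`).
[cite: StacksProject, Tag 01XD] [cite: StacksProject, Tag 01FM] [cite: Hartshorne1977, III Lemma 4.4, Thm. 4.5] -/
theorem _root_.Literature.Algebra.Homology.OrderedCech.exists_refineCochain_eq_add_sysD (k : ℕ)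
    (g' : OrderedCech.SysCochain (sectionsSystem V M ρ) ((k : ℤ) + 1))
    (hg' : OrderedCech.sysD (sectionsSystem V M ρ) ((k : ℤ) + 1) g' = 0) :
    ∃ (g : OrderedCech.SysCochain (sectionsSystem U M ρ) ((k : ℤ) + 1))
      (h : OrderedCech.SysCochain (sectionsSystem V M ρ) (k : ℤ)),
      OrderedCech.sysD (sectionsSystem U M ρ) ((k : ℤ) + 1) g = 0 ∧
      OrderedCech.refineCochain θ φ ((k : ℤ) + 1) g = g' + OrderedCech.sysD (sectionsSystem V M ρ) (k : ℤ) h := by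
  letI := HasExt.standard X.Modules
  set x' : Γ(CechOrd.obj V M (k + 1), ⊤) := (CechOrd.sectionsToSysCochain V M ρ (k + 1)).symm g' with hx'
  have hxg : CechOrd.sectionsToSysCochain V M ρ (k + 1) x' = g' := AddEquiv.apply_symm_apply _ g'
  have hg'' : OrderedCech.sysD (sectionsSystem V M ρ) ((k + 1 : ℕ) : ℤ) g' = 0 := hg'
  have hdx' : (CechOrd.d V M (k + 1)).app ⊤ x' = 0 := by
    apply (CechOrd.sectionsToSysCochain V M ρ (k + 1 + 1)).injective
    rw [CechOrd.sectionsToSysCochain_d, hxg, hg'', map_zero]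
  obtain ⟨c', y', hdc', hcy⟩ := CechOrd.exists_refineRes_eq_add_d U V M θ hV
    (fun β => isAffineOpen_face_of_cechOpen U hUa β) (isAffineOpen_faceSet_of_cechOpen V hVa) hUcov hVcov hM k x' hdx'
  set c : OrderedCech.Full.Cochain (sectionsSystem U M ρ) (k + 1) := Cech.sectionsToCochain U M ρ (k + 1) c' with hc
  set y : OrderedCech.SysCochain (sectionsSystem V M ρ) (k : ℤ) := CechOrd.sectionsToSysCochain V M ρ k y' with hy
  have hdc : ((OrderedCech.Full.complex (sectionsSystem U M ρ)).d (k + 1) (k + 1 + 1)).hom c = 0 := by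
    rw [hc, ← Cech.sectionsToCochain_dSections, hdc', map_zero]
  have hres : OrderedCech.Full.res (sectionsSystem V M ρ) (k + 1) (OrderedCech.Full.pullbackCochain θ φ (k + 1) c) =
      g' + OrderedCech.sysD (sectionsSystem V M ρ) (k : ℤ) y := by
    have hadd : CechOrd.sectionsToSysCochain V M ρ (k + 1) (x' + (CechOrd.d V M k).app ⊤ y') =
        CechOrd.sectionsToSysCochain V M ρ (k + 1) x' + CechOrd.sectionsToSysCochain V M ρ (k + 1) ((CechOrd.d V M k).app ⊤ y') :=
      map_add (CechOrd.sectionsToSysCochain V M ρ (k + 1)) _ _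
    rw [hc, ← Cech.sectionsToCochain_refineAlong U V M ρ θ hV φ hφ, ← CechOrd.sectionsToSysCochain_resOfFullObj, hcy, hadd, hxg,
      CechOrd.sectionsToSysCochain_d]
  set e : OrderedCech.Full.Cochain (sectionsSystem U M ρ) (k + 1) :=
    OrderedCech.Full.ext (sectionsSystem U M ρ) (k + 1) (OrderedCech.Full.res (sectionsSystem U M ρ) (k + 1) c) - c with he
  have hde : ((OrderedCech.Full.complex (sectionsSystem U M ρ)).d (k + 1) (k + 1 + 1)).hom e = 0 := by
    rw [he, map_sub, OrderedCech.Full.d_ext, OrderedCech.Full.sysD_res, hdc, map_zero, map_zero, sub_zero]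
  have hrese : OrderedCech.Full.res (sectionsSystem U M ρ) (k + 1) e =
      OrderedCech.sysD (sectionsSystem U M ρ) (k : ℤ) 0 := by
    rw [he, map_sub, OrderedCech.Full.res_ext, sub_self, map_zero]
  obtain ⟨w, hw⟩ := OrderedCech.Full.exists_d_eq_of_res_eq_sysD U M ρ hUa hUcov hM k e hde 0 hrese
  have hext : OrderedCech.Full.ext (sectionsSystem U M ρ) (k + 1) (OrderedCech.Full.res (sectionsSystem U M ρ) (k + 1) c) =
      c + e := by
    rw [he, add_sub_cancel]
  have hΘd : OrderedCech.Full.pullbackCochain θ φ (k + 1) (((OrderedCech.Full.complex (sectionsSystem U M ρ)).d k (k + 1)).hom w) =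
      ((OrderedCech.Full.complex (sectionsSystem V M ρ)).d k (k + 1)).hom (OrderedCech.Full.pullbackCochain θ φ k w) := by
    have hcomm := (OrderedCech.Full.pullback θ φ (M := sectionsSystem U M ρ) (M' := sectionsSystem V M ρ)).comm k (k + 1)
    rw [OrderedCech.Full.pullback_f, OrderedCech.Full.pullback_f] at hcomm
    exact (congrArg (fun f => f.hom w) hcomm).symm
  refine ⟨OrderedCech.Full.res (sectionsSystem U M ρ) (k + 1) c, y + OrderedCech.Full.res _ k (OrderedCech.Full.pullbackCochain θ φ k w), ?_, ?_⟩
  · refine (OrderedCech.Full.sysD_res (sectionsSystem U M ρ) (k + 1) c).trans ?_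
    rw [hdc, map_zero]
  · refine (OrderedCech.Full.res_pullbackCochain_ext θ φ (k + 1) _).symm.trans ?_
    rw [hext, map_add, map_add, hres, ← hw, hΘd, ← OrderedCech.Full.sysD_res, map_add, add_assoc]

include hφ hUcov hVcov in
omit [Fintype ι] in
/-- **Injectivity, cochain currency, degree `0`** (any covers `𝓤`, `𝓥`): an ordered `0`-cocycle `g` on `𝓤` with
`refineCochain θ φ g = 0` vanishes. [cite: StacksProject, Tag 01FG] [cite: Hartshorne1977, III Lemma 4.4] -/
theorem _root_.Literature.Algebra.Homology.OrderedCech.eq_zero_of_refineCochain_eq_zero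
    (g : OrderedCech.SysCochain (sectionsSystem U M ρ) ((0 : ℕ) : ℤ))
    (hg : OrderedCech.sysD (sectionsSystem U M ρ) ((0 : ℕ) : ℤ) g = 0)
    (hr : OrderedCech.refineCochain θ φ ((0 : ℕ) : ℤ) g = 0) : g = 0 := by
  letI := HasExt.standard X.Modules
  set c : OrderedCech.Full.Cochain (sectionsSystem U M ρ) 0 := OrderedCech.Full.ext (sectionsSystem U M ρ) 0 g with hc
  have hdc : ((OrderedCech.Full.complex (sectionsSystem U M ρ)).d 0 (0 + 1)).hom c = 0 := by
    rw [hc, OrderedCech.Full.d_ext, hg, map_zero]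
  have hres : OrderedCech.Full.res (sectionsSystem V M ρ) 0 (OrderedCech.Full.pullbackCochain θ φ 0 c) = 0 := by
    rw [hc, OrderedCech.Full.res_pullbackCochain_ext]
    exact hr
  set c' : Cech.Sections U 0 M ⊤ := (Cech.sectionsToCochain U M ρ 0).symm c with hc'
  have hcc : Cech.sectionsToCochain U M ρ 0 c' = c := AddEquiv.apply_symm_apply _ c
  have hdc' : Cech.dSections U M 0 ⊤ c' = 0 := by
    apply (Cech.sectionsToCochain U M ρ (0 + 1)).injective
    rw [Cech.sectionsToCochain_dSections, hcc, hdc, map_zero]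
  have hres' : ((CechOrd.resOfFullObj V M 0).app ⊤ ((Cech.refineAlong M θ hV 0).app ⊤ c') :
      Cech.Sections (CechOrd.faces V 0) 0 M ⊤) = 0 := by
    apply (CechOrd.sectionsToSysCochain V M ρ 0).injective
    rw [CechOrd.sectionsToSysCochain_resOfFullObj, Cech.sectionsToCochain_refineAlong U V M ρ θ hV φ hφ, hcc, hres, map_zero]
  have h0 := CechOrd.eq_zero_of_refineRes_eq_zero U V M θ hV hUcov hVcov c' hdc' hres'
  rw [← OrderedCech.Full.res_ext (sectionsSystem U M ρ) 0 g, ← hc, ← hcc, h0, map_zero, map_zero]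

include hφ hUcov hVcov in
omit [Fintype ι] in
/-- **Surjectivity, cochain currency, degree `0`** (any covers): every ordered `0`-cocycle `g′` on `𝓥` is `refineCochain θ φ g` for an
ordered `0`-cocycle `g` on `𝓤` (both are the families of restrictions of one global section).
[cite: StacksProject, Tag 01FG] [cite: Hartshorne1977, III Lemma 4.4] -/
theorem _root_.Literature.Algebra.Homology.OrderedCech.exists_refineCochain_eq_zero
    (g' : OrderedCech.SysCochain (sectionsSystem V M ρ) ((0 : ℕ) : ℤ))
    (hg' : OrderedCech.sysD (sectionsSystem V M ρ) ((0 : ℕ) : ℤ) g' = 0) :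
    ∃ g : OrderedCech.SysCochain (sectionsSystem U M ρ) ((0 : ℕ) : ℤ),
      OrderedCech.sysD (sectionsSystem U M ρ) ((0 : ℕ) : ℤ) g = 0 ∧ OrderedCech.refineCochain θ φ ((0 : ℕ) : ℤ) g = g' := by
  letI := HasExt.standard X.Modules
  set x' : Cech.Sections (CechOrd.faces V 0) 0 M ⊤ := (CechOrd.sectionsToSysCochain V M ρ 0).symm g' with hx'
  have hxg : CechOrd.sectionsToSysCochain V M ρ 0 x' = g' := AddEquiv.apply_symm_apply _ g'
  have hdx' : (CechOrd.d V M 0).app ⊤ x' = 0 := by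
    apply (CechOrd.sectionsToSysCochain V M ρ (0 + 1)).injective
    rw [CechOrd.sectionsToSysCochain_d, hxg, hg', map_zero]
  obtain ⟨c', hdc', hcy⟩ := CechOrd.exists_refineRes_eq_zero U V M θ hV hUcov hVcov x' hdx'
  set c : OrderedCech.Full.Cochain (sectionsSystem U M ρ) 0 := Cech.sectionsToCochain U M ρ 0 c' with hc
  have hdc : ((OrderedCech.Full.complex (sectionsSystem U M ρ)).d 0 (0 + 1)).hom c = 0 := by
    rw [hc, ← Cech.sectionsToCochain_dSections, hdc', map_zero]
  have hres : OrderedCech.Full.res (sectionsSystem V M ρ) 0 (OrderedCech.Full.pullbackCochain θ φ 0 c) = g' := by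
    rw [hc, ← Cech.sectionsToCochain_refineAlong U V M ρ θ hV φ hφ, ← CechOrd.sectionsToSysCochain_resOfFullObj, hcy, hxg]
  refine ⟨OrderedCech.Full.res (sectionsSystem U M ρ) 0 c, ?_, ?_⟩
  · rw [OrderedCech.Full.sysD_res, hdc, map_zero]
  · rw [← OrderedCech.Full.res_pullbackCochain_ext, OrderedCech.Full.ext_res_zero, hres]

end Cochain

/-! ## §3 The comparison, class form -/

section Classes

variable [Fintype ι] [Fintype ι'] (hUa : ∀ s : Finset ι, s.Nonempty → IsAffineOpen (cechOpen U s))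
  (hVa : ∀ s : Finset ι', s.Nonempty → IsAffineOpen (cechOpen V s))
  (hUcov : ⨆ i, U i = ⊤) (hVcov : ⨆ j, V j = ⊤) (hM : IsAffineLocalizing M)

include hφ hUa hVa hUcov hVcov hM in
/-- **(G5-c) THE REFINEMENT MAP IS BIJECTIVE ON ORDERED ČECH COHOMOLOGY, class form**: for finite covers `𝓤`, `𝓥` of `X` with
affine non-empty finite intersections, `𝓥` refining `𝓤` along ANY `θ`, `M` affine-localizing and `φ` a restriction datum (`hφ`),
EVERY cochain map `F : Č(𝓤, M) ⟶ Č(𝓥, M)` whose components ARE `refineCochain θ φ` (e.g. ★ `refineComplexMap θ φ`) is bijective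
on `Ȟⁿ` for every `n : ℤ` (both sides compute `Hⁿ(X, M)` by Leray, compatibly with the refinement).
[cite: StacksProject, Tag 01XD] [cite: StacksProject, Tag 01FG] [cite: GortzWedhorn2023, Thm. 22.9 (p. 236)] [cite: Hartshorne1977, III Thm. 4.5] -/
theorem homologyMap_bijective_of_refineCochain (F : cechComplex U M ρ ⟶ cechComplex V M ρ)
    (hF : ∀ (n : ℤ) (g : OrderedCech.SysCochain (sectionsSystem U M ρ) n),
      (F.f n).hom g = OrderedCech.refineCochain θ φ n g)
    (j : ℤ) : Function.Bijective (HomologicalComplex.homologyMap F j).hom := by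
  rcases lt_trichotomy j 0 with hj | rfl | hj
  · -- negative degrees: all cochain modules are trivial
    haveI hU0 : Subsingleton (OrderedCech.SysCochain (sectionsSystem U M ρ) j) := by
      haveI := OrderedCech.isEmpty_simplex_of_neg (ι := ι) hj
      unfold OrderedCech.SysCochain; infer_instance
    haveI hV0 : Subsingleton (OrderedCech.SysCochain (sectionsSystem V M ρ) j) := by
      haveI := OrderedCech.isEmpty_simplex_of_neg (ι := ι') hj
      unfold OrderedCech.SysCochain; infer_instance
    refine HomologyElementwise.homologyMap_bijective_of_elementwise F j ?_ ?_
    · intro x _ _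
      exact ⟨0, by rw [map_zero]; exact @Subsingleton.elim _ hU0 _ _⟩
    · intro x' _
      refine ⟨0, 0, by rw [map_zero], ?_⟩
      rw [map_zero, map_zero, add_zero]
      exact @Subsingleton.elim _ hV0 _ _
  · -- degree `0`
    haveI hV0 : Subsingleton (OrderedCech.SysCochain (sectionsSystem V M ρ) ((0 : ℤ) - 1)) := by
      haveI := OrderedCech.isEmpty_simplex_of_neg (ι := ι') (n := (0 : ℤ) - 1) (by decide)
      unfold OrderedCech.SysCochain; infer_instance
    refine HomologyElementwise.homologyMap_bijective_of_elementwise F 0 ?_ ?_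
    · rintro x hx ⟨y', hy'⟩
      have hy0 : y' = 0 := @Subsingleton.elim _ hV0 _ _
      have hxd : OrderedCech.sysD (sectionsSystem U M ρ) ((0 : ℕ) : ℤ) x = 0 := by
        rw [OrderedCech.sysComplex_d] at hx; exact hx
      have hFx : (F.f 0).hom x = 0 := by rw [← hy', hy0, map_zero]
      have hr : OrderedCech.refineCochain θ φ ((0 : ℕ) : ℤ) x = 0 := by
        rw [← hF]; exact hFx
      have hx0 := OrderedCech.eq_zero_of_refineCochain_eq_zero U V M ρ θ hV φ hφ hUcov hVcov x hxd hr
      exact ⟨0, by rw [map_zero]; exact hx0.symm⟩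
    · intro x' hx'
      have hxd' : OrderedCech.sysD (sectionsSystem V M ρ) ((0 : ℕ) : ℤ) x' = 0 := by
        rw [OrderedCech.sysComplex_d] at hx'; exact hx'
      obtain ⟨g, hg, hgr⟩ := OrderedCech.exists_refineCochain_eq_zero U V M ρ θ hV φ hφ hUcov hVcov x' hxd'
      refine ⟨g, 0, ?_, ?_⟩
      · rw [OrderedCech.sysComplex_d]; exact hg
      · rw [map_zero, add_zero, hF]; exact hgr
  · -- positive degrees `j = k + 1`
    obtain ⟨k, rfl⟩ : ∃ k : ℕ, j = (k : ℤ) + 1 := ⟨(j - 1).toNat, by omega⟩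
    have hk : (k : ℤ) + 1 - 1 = k := by omega
    refine HomologyElementwise.homologyMap_bijective_of_elementwise F ((k : ℤ) + 1) ?_ ?_
    · rintro x hx ⟨y', hy'⟩
      have hxd : OrderedCech.sysD (sectionsSystem U M ρ) ((k : ℤ) + 1) x = 0 := by
        rw [OrderedCech.sysComplex_d] at hx; exact hx
      have hyd : OrderedCech.sysD (sectionsSystem V M ρ) (k : ℤ) (((cechComplex V M ρ).XIsoOfEq hk).hom.hom y') =
          (F.f ((k : ℤ) + 1)).hom x := by
        have e1 := congrArg (fun f => f.hom y')
          (HomologicalComplex.XIsoOfEq_hom_comp_d (cechComplex V M ρ) hk ((k : ℤ) + 1))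
        rw [OrderedCech.sysComplex_d] at e1
        exact e1.trans hy'
      have hr : OrderedCech.refineCochain θ φ ((k : ℤ) + 1) x =
          OrderedCech.sysD (sectionsSystem V M ρ) (k : ℤ) (((cechComplex V M ρ).XIsoOfEq hk).hom.hom y') := by
        rw [hyd, hF]
      obtain ⟨g₀, hg₀⟩ := OrderedCech.exists_eq_sysD_of_refineCochain_eq_sysD U V M ρ θ hV φ hφ hUa hVa hUcov hVcov hM k x
        hxd _ hr
      refine ⟨((cechComplex U M ρ).XIsoOfEq hk).inv.hom g₀, ?_⟩
      have e2 := congrArg (fun f => f.hom g₀)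
        (HomologicalComplex.XIsoOfEq_inv_comp_d (cechComplex U M ρ) hk ((k : ℤ) + 1))
      rw [OrderedCech.sysComplex_d] at e2
      exact e2.trans hg₀
    · intro x' hx'
      have hxd' : OrderedCech.sysD (sectionsSystem V M ρ) ((k : ℤ) + 1) x' = 0 := by
        rw [OrderedCech.sysComplex_d] at hx'; exact hx'
      obtain ⟨g, h, hg, hgr⟩ := OrderedCech.exists_refineCochain_eq_add_sysD U V M ρ θ hV φ hφ hUa hVa hUcov hVcov hM k x' hxd'
      refine ⟨g, ((cechComplex V M ρ).XIsoOfEq hk).inv.hom h, ?_, ?_⟩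
      · rw [OrderedCech.sysComplex_d]; exact hg
      · have e3 := congrArg (fun f => f.hom h)
          (HomologicalComplex.XIsoOfEq_inv_comp_d (cechComplex V M ρ) hk ((k : ℤ) + 1))
        rw [OrderedCech.sysComplex_d] at e3
        rw [hF]
        change _ = x' + ((((cechComplex V M ρ).XIsoOfEq hk).inv ≫ (cechComplex V M ρ).d ((k : ℤ) + 1 - 1) ((k : ℤ) + 1)).hom h)
        rw [e3]
        exact hgr

end Classes

/-! ## §4 The F-J3b instance: `M = 𝒪_X`, `φ = pullbackSystemHom (𝟙 X)` -/

/-- **(G5-c) for `𝒪_X` and the identity pull-back** (`r^*` of F-J3b): for finite covers `𝓤`, `𝓥` of `X` with affine non-empty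
finite intersections, `𝓥` refining `𝓤` along ANY `θ`, ★ `refineComplexMap θ (pullbackSystemHom (𝟙 X) 𝓤 𝓥 θ …)` is BIJECTIVE on
`Ȟⁿ(–, 𝒪_X)` for every `n : ℤ` (so `m^* := (r^*)⁻¹ ∘ H(refine_{θ_m})` is defined on the product∕triple covers of `A × A`).
[cite: StacksProject, Tag 01XD] [cite: StacksProject, Tag 01FG] [cite: GortzWedhorn2023, Thm. 22.9 (p. 236)] [cite: Hartshorne1977, III Thm. 4.5] -/
theorem homologyMap_refineComplexMap_pullbackSystemHom_id_bijective [Fintype ι] [Fintype ι']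
    (hθ : ∀ c, V c ≤ (𝟙 X : X ⟶ X) ⁻¹ᵁ U (θ c)) (hρ : ∀ a, ρ a = (𝟙 X : X ⟶ X).appTop (ρ a))
    (hUa : ∀ s : Finset ι, s.Nonempty → IsAffineOpen (cechOpen U s))
    (hVa : ∀ s : Finset ι', s.Nonempty → IsAffineOpen (cechOpen V s))
    (hUcov : ⨆ i, U i = ⊤) (hVcov : ⨆ j, V j = ⊤) (n : ℤ) :
    Function.Bijective (HomologicalComplex.homologyMap
      (OrderedCech.refineComplexMap θ (pullbackSystemHom (𝟙 X) U V θ hθ ρ ρ hρ)) n).hom := by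
  have hV : ∀ j, V j ≤ U (θ j) := hθ
  refine homologyMap_bijective_of_refineCochain U V (unitModule X) ρ θ hV (pullbackSystemHom (𝟙 X) U V θ hθ ρ ρ hρ) ?_
    hUa hVa hUcov hVcov IsAffineLocalizing.unit _ (fun n g => OrderedCech.refineComplexMap_f_apply _ _ n g) n
  intro s' x
  apply SecMod.toRing_injective ρ
  rw [toRing_pullbackSystemHom_id, SecMod.toRing_res]
  rfl

end Literature.AlgebraicGeometry.Modules

end
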